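import Literature.IUT.HodgeArakelov.MonoThetaProjectiveProp16EllipticRefGenuine
import Literature.IUT.HodgeTheaters.StableCurveTemperedDataOfSpecialFibreCor25
import HarnessLib

/-!
# [IUTchII] Prop. 1.6 (ii): the successor predicate `RefIsElliptic` is satisfied by the IDENTITY output
# (no cusp removed) — a kernel T1 witness (RQ7 lane abc-iut-L6-t21, gen 10)

S. Mochizuki, *Inter-universal Teichmüller Theory II*, kurims manuscript (Dec. 2020), §1, Prop. 1.6 (ii) p. 31
l. 34–41 ("… the surjection `Π_{U_N}(Π) ↠ Π` may be naturally identified with a certain surjection — i.e., “elliptic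
cuspidalization” — that arises from a certain open immersion determined by the `N`-torsion points of a
once-punctured elliptic curve …") [claim: Mochizuki2012, status: disputed] (IUTchII §1 Prop 1.6 (ii), kurims p.31);
[AbsTopII] Cor. 3.3 (iii) pp. 67–69 [cite: MochizukiAbsTopII2013, Cor 3.3 (iii) p.68].

WHAT IS SHOWN (proofs only about the tree's own typed objects; nothing printed is asserted). For EVERY setting `S`,
label `N`, tempered curve `X` identified with the setting (`eX`, clause (R0)), and junction datum `(E, iX)` for `Π̂_X`
whose `Δ` is torsion-free and which carries one centre-free normal open subgroup `V` (both hold for genuine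
hyperbolic curves), the successor predicate `EllipticCuspidalization.RefIsElliptic` (abc-iut-w5-d030, p437894) HOLDS for
the IDENTITY output `Π_{U_N}(Π) := Π`, `U := X`, reference surjection `:= id`, removed-cusp set `R := ∅`, with the
[AbsTopII] Cor. 3.3 (iii) record of clause (R2) taken to be a record WITHOUT CUSPS whose cuspidalization `Π_{U_X} ↠ Π`
is the identity and whose label is `N` (`identityRecord`: core `Π × ℤ/2`, `Π_D = Π × 1`, `Π_V = V`, `Π_U = Π_{U_X} = Π`).
Hence `EllipticCuspidalization.Genuine S N S.PiX X X eX` is inhabited with `U = X` (`nonempty_genuine_self`); slim form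
with `V := Π̂_X` itself under `Subgroup.center E.arith = ⊥` (`…_of_center_eq_bot`). `Π^tp_X` is Hausdorff by the
interface (abc-iut-L5's `StableCurveTemperedData.t2Space_piTemp`, reused), so no separation hypothesis is needed.

READING (RQ7 T1 «inhabited from degeneracy»): as typed, (R1) binds the removed-cusp set only existentially and (R2)
pins `N` to the label field of the [AbsTopII] Cor. 3.3 (iii) OUTPUT record, which abc-iut-L4-lead books
«CONTENT-LIGHT AS TYPED (F-f067-1)»; the L4 content conjunct `AbsTopII.EllipticCuspidalization.RealizesChain`
(`N² − 1` de-cuspidalization steps) / successor `EllipticDatumModel.Cor_3_3_iii″` is not required by (R2). So the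
predicate does not force any cusp of `U` to be removed nor relate `N` to removed points. A v-next conjoining
`RealizesChain` (or `Cor_3_3_iii″`) in (R2) would exclude this witness. HONEST SCOPE: a statement about the tree's
typing only; no side is taken on [IUTchIII] Cor. 3.12 or on any author; typed ≠ proved; vacuous-as-typed ≠ false-in-print.
-/

noncomputable section

open CategoryTheory Topology
open scoped Pointwise

namespace Literature.IUT.HodgeArakelov

namespace EllipticCuspidalization

namespace IdentityWitness

open Literature.AnabelianGeometry.AbsoluteAnabelian
open Literature.AnabelianGeometry.SemiGraphs (TemperedCurve)

/-! ## §1. An [AbsTopII] Cor. 3.3 (iii) output record WITHOUT CUSPS over any extension `E` (label `N` arbitrary) -/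

section L4

variable (E : FundamentalExtension.{0})

/-- The two-element group `ℤ/2` (multiplicative, discrete). [cite: MochizukiAbsTopII2013, Cor 3.3 (ii) p.68] -/
abbrev C2 : Type := Multiplicative (ZMod 2)

/-- The «core» extension `Π × ℤ/2 ↠ G` (augmentation through the first factor): it contains `Π = Π × 1` as an open
subgroup of index `2`, playing `Π_D ⊆ Π_C`. [cite: MochizukiAbsTopII2013, Cor 3.3 (i) p.68] -/
def coreExt : FundamentalExtension.{0} where
  arith := ProfiniteGrp.of (E.arith × C2)
  gal := E.gal
  aug := E.aug.comp (ContinuousMonoidHom.fst E.arith C2)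
  aug_surjective g := by
    obtain ⟨x, hx⟩ := E.aug_surjective g
    exact ⟨(x, 1), hx⟩

/-- `Π → Π × ℤ/2`, `x ↦ (x, 1)`, over the identity of `G`. [cite: MochizukiAbsTopII2013, Cor 3.3 (i) p.68] -/
def toCore : E ⟶ coreExt E where
  arith := ContinuousMonoidHom.inl E.arith C2
  gal := ContinuousMonoidHom.id E.gal
  comm _ := rfl

/-- `x ↦ (x, 1)` is injective. [cite: MochizukiAbsTopII2013, Cor 3.3 (i) p.68] -/
theorem toCore_arith_injective : Function.Injective (toCore E).arith :=
  fun _ _ h => (Prod.ext_iff.1 h).1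

/-- The range of `x ↦ (x, 1)` is `Π × 1`. [cite: MochizukiAbsTopII2013, Cor 3.3 (i) p.68] -/
theorem range_toCore_arith :
    (toCore E).arith.toMonoidHom.range = (⊤ : Subgroup E.arith).prod (⊥ : Subgroup C2) := by
  apply le_antisymm
  · rintro _ ⟨y, rfl⟩
    exact Subgroup.mem_prod.2 ⟨Subgroup.mem_top _, Subgroup.mem_bot.2 rfl⟩
  · rintro ⟨x, c⟩ h
    have hc : c = 1 := Subgroup.mem_bot.1 (Subgroup.mem_prod.1 h).2
    subst hc
    exact ⟨x, rfl⟩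

/-- `Π × 1` is open in `Π × ℤ/2`. [cite: MochizukiAbsTopII2013, Cor 3.3 (ii) p.68] -/
theorem isOpen_prod_top_bot :
    IsOpen (((⊤ : Subgroup E.arith).prod (⊥ : Subgroup C2) : Subgroup (E.arith × C2)) : Set (E.arith × C2)) := by
  rw [Subgroup.coe_prod, Subgroup.coe_top, Subgroup.coe_bot]
  exact isOpen_univ.prod (isOpen_discrete _)

/-- `Π × 1` has index `2` in `Π × ℤ/2`. [cite: MochizukiAbsTopII2013, Cor 3.3 (ii) p.68] -/
theorem index_prod_top_bot : ((⊤ : Subgroup E.arith).prod (⊥ : Subgroup C2)).index = 2 := by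
  rw [Subgroup.index_prod, Subgroup.index_top, Subgroup.index_bot, one_mul]
  change Nat.card (Multiplicative (ZMod 2)) = 2
  rw [Nat.card_congr Multiplicative.toAdd, Nat.card_zmod]

variable {E} in
/-- Transport of `center = ⊥` along an equality of subgroups. [folklore] -/
private theorem center_eq_bot_of_eq {G : Type*} [Group G] {H K : Subgroup G} (h : H = K)
    (hK : Subgroup.center K = ⊥) : Subgroup.center H = ⊥ := by
  subst h
  exact hK

/-- Pulling a subgroup back along the identity morphism of `E` does nothing. [folklore] -/
private theorem comap_id_arith_eq (V : Subgroup E.arith) : V.comap (𝟙 E : E ⟶ E).arith.toMonoidHom = V :=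
  Subgroup.ext fun _ => Iff.rfl

/-- `Π_V ↦ Π_V × 1 ↦ Π_V`: pull-back of the push-forward along the injection `x ↦ (x,1)`. [folklore] -/
private theorem comap_map_toCore_eq (V : Subgroup E.arith) :
    (V.map (toCore E).arith.toMonoidHom).comap (toCore E).arith.toMonoidHom = V :=
  Subgroup.comap_map_eq_self_of_injective (toCore_arith_injective E) V

/-- **An [AbsTopII] Cor. 3.3 (iii) OUTPUT RECORD WITHOUT CUSPS, label `N`, cuspidalization `Π_{U_X} ↠ Π` THE
IDENTITY**, over any extension `E` whose `Δ` is torsion-free and which has a centre-free normal open subgroup `V`: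
core `Π × ℤ/2`, `Π_D = Π × 1` (open, index `2`, `Π_D ∩ Δ_C ≅ Δ` torsion-free), `Π_V = V`, `Π_U = Π` with
`Π_U ↠ Π_D` the inclusion `x ↦ (x,1)`, `Π_{U_X} = Π` with `proj = 𝟙`, no cusps, any `Σ ⊇ primes(N)` (here all of `ℕ`).
[cite: MochizukiAbsTopII2013, Cor 3.3 (iii) p.68] -/
def identityRecord (N : ℕ+) (htf : IsMulTorsionFree E.geom) (V : Subgroup E.arith) [hVn : V.Normal]
    (hVo : IsOpen (V : Set E.arith)) (hVc : Subgroup.center V = ⊥) : AbsTopII.EllipticCuspidalization E where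
  N := N
  Sigma := Set.univ
  N_isSigmaInteger := ⟨N.pos, fun _ _ _ => Set.mem_univ _⟩
  core := coreExt E
  toCore := toCore E
  toCore_isOpenInjective :=
    { arith_injective := toCore_arith_injective E
      isOpen_range_arith := by
        have h : Set.range (toCore E).arith = (((⊤ : Subgroup E.arith).prod (⊥ : Subgroup C2) :
            Subgroup (E.arith × C2)) : Set (E.arith × C2)) := by
          rw [← range_toCore_arith E]; rfl
        rw [h]
        exact isOpen_prod_top_bot E
      gal_injective := Function.injective_id
      isOpen_range_gal := by
        have h : Set.range (toCore E).gal = Set.univ := Set.range_eq_univ.2 Function.surjective_id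
        rw [h]; exact isOpen_univ }
  toCore_gal_bijective := Function.bijective_id
  PiD := (⊤ : Subgroup E.arith).prod (⊥ : Subgroup C2)
  isOpen_PiD := isOpen_prod_top_bot E
  index_PiD := index_prod_top_bot E
  torsionFree_PiD := ⟨fun n hn a b hab => by
    obtain ⟨⟨a1, a2⟩, ha⟩ := a
    obtain ⟨⟨b1, b2⟩, hb⟩ := b
    have ha' := Subgroup.mem_inf.1 ha
    have hb' := Subgroup.mem_inf.1 hb
    have ha2 : a2 = 1 := Subgroup.mem_bot.1 (Subgroup.mem_prod.1 ha'.1).2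
    have hb2 : b2 = 1 := Subgroup.mem_bot.1 (Subgroup.mem_prod.1 hb'.1).2
    have ha1 : a1 ∈ E.geom := ha'.2
    have hb1 : b1 ∈ E.geom := hb'.2
    have hpow : a1 ^ n = b1 ^ n := by
      have h := congrArg (fun z : ↥(((⊤ : Subgroup E.arith).prod (⊥ : Subgroup C2)) ⊓ (coreExt E).geom) =>
        (z.1).1) hab
      exact h
    have h1 : (⟨a1, ha1⟩ : E.geom) = ⟨b1, hb1⟩ :=
      htf.pow_left_injective hn (Subtype.ext (by simpa using hpow))
    have h1' : a1 = b1 := congrArg Subtype.val h1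
    subst h1' ha2 hb2
    rfl⟩
  PiV := V
  normal_PiV := hVn
  isOpen_PiV := hVo
  map_PiV_le := by
    rintro _ ⟨v, -, rfl⟩
    exact Subgroup.mem_prod.2 ⟨Subgroup.mem_top _, Subgroup.mem_bot.2 rfl⟩
  cuspU := E
  projU := toCore E
  range_projU := range_toCore_arith E
  projU_gal_bijective := Function.bijective_id
  cuspUX := E
  proj := 𝟙 E
  proj_arith_surjective := Function.surjective_id
  proj_gal_bijective := Function.bijective_id
  glue := (MulEquiv.subgroupCongr (comap_id_arith_eq E V)).trans
    (MulEquiv.subgroupCongr (comap_map_toCore_eq E V).symm)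
  glue_comm _ := rfl
  lifting_unique ρ ρ' _ _ hρ hρ' := by
    ext g
    obtain ⟨a, ha, hax⟩ := hρ g
    obtain ⟨a', ha', hax'⟩ := hρ' g
    have haa : a = a' := by
      ext x
      exact (hax x).trans (hax' x).symm
    rw [← ha, ← ha', haa]
  center_PiUV_eq_bot := center_eq_bot_of_eq (Subgroup.ext fun _ => Iff.rfl) hVc
  cusps :=
    { Cusp := PEmpty.{1}
      Dcusp := fun x => x.elim
      Icusp := fun x => x.elim
      Icusp_eq := fun x => x.elim
      isClosed_Dcusp := fun x => x.elim
      eq_of_conj := fun x => x.elim }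

/-- The record's label is `N`. [cite: MochizukiAbsTopII2013, Cor 3.3 (iii) p.68] -/
theorem identityRecord_N (N : ℕ+) (htf : IsMulTorsionFree E.geom) (V : Subgroup E.arith) [V.Normal]
    (hVo : IsOpen (V : Set E.arith)) (hVc : Subgroup.center V = ⊥) :
    (identityRecord E N htf V hVo hVc).N = (N : ℕ) := rfl

/-- The record has NO cusps. [cite: MochizukiAbsTopII2013, Cor 3.3 (iii) p.68] -/
theorem isEmpty_cusps (N : ℕ+) (htf : IsMulTorsionFree E.geom) (V : Subgroup E.arith) [V.Normal]
    (hVo : IsOpen (V : Set E.arith)) (hVc : Subgroup.center V = ⊥) :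
    IsEmpty (identityRecord E N htf V hVo hVc).cusps.Cusp :=
  ⟨fun x => by cases x⟩

/-- The record's cuspidalization `Π_{U_X} ↠ Π` is the identity. [cite: MochizukiAbsTopII2013, Cor 3.3 (iii) p.68] -/
theorem identityRecord_proj (N : ℕ+) (htf : IsMulTorsionFree E.geom) (V : Subgroup E.arith) [V.Normal]
    (hVo : IsOpen (V : Set E.arith)) (hVc : Subgroup.center V = ⊥) :
    (identityRecord E N htf V hVo hVc).proj = 𝟙 E := rfl

/-- … so on elements it is the identity map. [cite: MochizukiAbsTopII2013, Cor 3.3 (iii) p.68] -/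
theorem identityRecord_proj_arith_apply (N : ℕ+) (htf : IsMulTorsionFree E.geom) (V : Subgroup E.arith) [V.Normal]
    (hVo : IsOpen (V : Set E.arith)) (hVc : Subgroup.center V = ⊥) (x : E.arith) :
    (identityRecord E N htf V hVo hVc).proj.arith x = x := by
  rw [identityRecord_proj]; rfl

end L4

/-! ## §2. The IDENTITY output of IUTchII:Prop1.6(ii) over a setting `S` and the predicate `RefIsElliptic` at `U = X` -/

section L6

variable (S : ThetaSetting.{0}) (N : ℕ+)

/-- The IDENTITY output `Π_{U_N}(Π) := Π ↠ Π` with reference surjection `:= id` (cf. the interface-level witness of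
`EllipticCuspidalization.nonempty_iff`, p412824). [claim: Mochizuki2012, status: disputed] (IUTchII §1 Prop 1.6 (ii), kurims p.31) -/
def idOutput : EllipticCuspidalization S N S.PiX where
  isoRef := ⟨ContinuousMulEquiv.refl _⟩
  PiU := S.PiX
  proj := MonoidHom.id _
  proj_continuous := continuous_id
  proj_surjective := Function.surjective_id
  PiURef := S.PiX
  projRef := MonoidHom.id _
  identified := ⟨ContinuousMulEquiv.refl _, ContinuousMulEquiv.refl _, fun _ => rfl⟩

variable {p : ℕ} [Fact p.Prime] (X : TemperedCurve p) (eX : X.PiTemp ≃ₜ* S.PiX)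

/-- The tempered reading of the identity output's reference surjection at `U := X` is the identity of `Π^tp_X`:
NO cusp is removed. [claim: Mochizuki2012, status: disputed] (IUTchII §1 Prop 1.6 (ii), kurims p.31) -/
theorem refHom_idOutput_apply (y : X.PiTemp) : (idOutput S N).refHom X X eX eX y = y := by
  rw [EllipticCuspidalization.refHom_apply]
  exact eX.symm_apply_apply y

/-- Hence its kernel is trivial. [claim: Mochizuki2012, status: disputed] (IUTchII §1 Prop 1.6 (ii), kurims p.31) -/
theorem ker_refHom_idOutput : ((idOutput S N).refHom X X eX eX).ker = ⊥ := by
  refine le_antisymm (fun y hy => ?_) bot_le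
  rw [MonoidHom.mem_ker, refHom_idOutput_apply] at hy
  exact Subgroup.mem_bot.2 hy

/-- In a `T₁` group the closed normal subgroup generated by NO inertia groups is trivial. [folklore] -/
private theorem closure_normalClosure_empty_eq_bot {G : Type*} [Group G] [TopologicalSpace G] [IsTopologicalGroup G]
    [T1Space G] {ι : Type*} (I : ι → Set G) :
    (Subgroup.normalClosure (⋃ x ∈ (∅ : Set ι), I x)).topologicalClosure = ⊥ := by
  have h0 : Subgroup.normalClosure (⋃ x ∈ (∅ : Set ι), I x) = ⊥ :=
    le_antisymm (Subgroup.normalClosure_le_normal (by simp)) bot_le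
  rw [h0]
  apply SetLike.coe_injective
  rw [Subgroup.topologicalClosure_coe, Subgroup.coe_bot, closure_singleton]

/-- **T1 WITNESS.** For every setting `S`, label `N`, tempered curve `X` with (R0)-identification `eX` (its tempered group is
Hausdorff, `StableCurveTemperedData.t2Space_piTemp`), and junction datum `(E, iX)` for `Π̂_X` with torsion-free `Δ` and a centre-free normal open `V`, the successor
predicate `RefIsElliptic` HOLDS for the identity output at `U := X`, `eU := eX`: removed-cusp set `R = ∅`, clause (R2)
met by `identityRecord` (no cusps, `proj = 𝟙`, label `N`).
[claim: Mochizuki2012, status: disputed] (IUTchII §1 Prop 1.6 (ii), kurims p.31) -/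
theorem refIsElliptic_idOutput_self
    (hR0 : X.DeltaTemp.map eX.toMulEquiv.toMonoidHom = S.DeltaX)
    (E : FundamentalExtension.{0}) (iX : X.PiHat ≃ₜ* E.arith) (hgeom : ∀ z : X.PiHat, iX z ∈ E.geom ↔ z ∈ X.DeltaHat)
    (htf : IsMulTorsionFree E.geom) (V : Subgroup E.arith) [V.Normal] (hVo : IsOpen (V : Set E.arith))
    (hVc : Subgroup.center V = ⊥) :
    (idOutput S N).RefIsElliptic X X eX eX where
  deltaTemp_eq := hR0
  K_eq := rfl
  continuous_projRef := continuous_id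
  aug_comp y := by rw [refHom_idOutput_apply]
  kernel_eq := by
    haveI := Literature.IUT.HodgeTheaters.StableCurveTemperedData.t2Space_piTemp X
    exact ⟨∅, fun _ h => h.elim,
      (ker_refHom_idOutput S N X eX).trans (closure_normalClosure_empty_eq_bot _).symm, fun _ h => h.elim⟩
  elliptic := ⟨E, iX, identityRecord E N htf V hVo hVc, iX, rfl, hgeom, fun y => by
    rw [refHom_idOutput_apply]
    exact identityRecord_proj_arith_apply E N htf V hVo hVc _⟩

/-- **COROLLARY.** The GENUINE output structure `EllipticCuspidalization.Genuine S N S.PiX X X eX` (abc-iut-w5-d030,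
p439458) is inhabited with `U = X` and the identity as «elliptic cuspidalization», under the same hypotheses.
[claim: Mochizuki2012, status: disputed] (IUTchII §1 Prop 1.6 (ii), kurims p.31) -/
theorem nonempty_genuine_self
    (hR0 : X.DeltaTemp.map eX.toMulEquiv.toMonoidHom = S.DeltaX)
    (E : FundamentalExtension.{0}) (iX : X.PiHat ≃ₜ* E.arith) (hgeom : ∀ z : X.PiHat, iX z ∈ E.geom ↔ z ∈ X.DeltaHat)
    (htf : IsMulTorsionFree E.geom) (V : Subgroup E.arith) [V.Normal] (hVo : IsOpen (V : Set E.arith))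
    (hVc : Subgroup.center V = ⊥) :
    Nonempty (EllipticCuspidalization.Genuine S N S.PiX X X eX) :=
  ⟨{ toEllipticCuspidalization := idOutput S N
     eU := eX
     refIsElliptic := refIsElliptic_idOutput_self S N X eX hR0 E iX hgeom htf V hVo hVc }⟩

/-- Centre of `Π` trivial ⇒ centre of the improper subgroup `⊤ ≤ Π` trivial. [folklore] -/
private theorem center_top_eq_bot {G : Type*} [Group G] (h : Subgroup.center G = ⊥) :
    Subgroup.center (⊤ : Subgroup G) = ⊥ := by
  refine eq_bot_iff.2 fun z hz => ?_
  have hz' : (z : G) ∈ Subgroup.center G := by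
    rw [Subgroup.mem_center_iff]
    intro g
    exact congrArg Subtype.val (Subgroup.mem_center_iff.1 hz ⟨g, Subgroup.mem_top g⟩)
  rw [h] at hz'
  exact Subgroup.mem_bot.2 (Subtype.ext (Subgroup.mem_bot.1 hz'))

/-- **T1 WITNESS, slim form** (`V := Π̂_X` itself): if `Π̂_X ≅ E.arith` has trivial centre (slimness, as for every
hyperbolic curve) and torsion-free `Δ`, the identity output satisfies `RefIsElliptic` at `U := X`.
[claim: Mochizuki2012, status: disputed] (IUTchII §1 Prop 1.6 (ii), kurims p.31) -/
theorem refIsElliptic_idOutput_self_of_center_eq_bot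
    (hR0 : X.DeltaTemp.map eX.toMulEquiv.toMonoidHom = S.DeltaX)
    (E : FundamentalExtension.{0}) (iX : X.PiHat ≃ₜ* E.arith) (hgeom : ∀ z : X.PiHat, iX z ∈ E.geom ↔ z ∈ X.DeltaHat)
    (htf : IsMulTorsionFree E.geom) (hZ : Subgroup.center E.arith = ⊥) :
    (idOutput S N).RefIsElliptic X X eX eX :=
  refIsElliptic_idOutput_self S N X eX hR0 E iX hgeom htf ⊤ (by rw [Subgroup.coe_top]; exact isOpen_univ)
    (center_top_eq_bot hZ)

/-- **COROLLARY, slim form**: `EllipticCuspidalization.Genuine S N S.PiX X X eX` is inhabited with `U = X` whenever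
`Π̂_X` is centre-free with torsion-free `Δ` (and (R0), junction datum).
[claim: Mochizuki2012, status: disputed] (IUTchII §1 Prop 1.6 (ii), kurims p.31) -/
theorem nonempty_genuine_self_of_center_eq_bot
    (hR0 : X.DeltaTemp.map eX.toMulEquiv.toMonoidHom = S.DeltaX)
    (E : FundamentalExtension.{0}) (iX : X.PiHat ≃ₜ* E.arith) (hgeom : ∀ z : X.PiHat, iX z ∈ E.geom ↔ z ∈ X.DeltaHat)
    (htf : IsMulTorsionFree E.geom) (hZ : Subgroup.center E.arith = ⊥) :
    Nonempty (EllipticCuspidalization.Genuine S N S.PiX X X eX) :=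
  ⟨{ toEllipticCuspidalization := idOutput S N
     eU := eX
     refIsElliptic := refIsElliptic_idOutput_self_of_center_eq_bot S N X eX hR0 E iX hgeom htf hZ }⟩

end L6

end IdentityWitness

end EllipticCuspidalization

end Literature.IUT.HodgeArakelov

end
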